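import Summits.RiemannHypothesis.RiemannHypothesis.Theorems.GroundBartaEvenWinsBeyondArchDeflationArchLoc1
import Summits.RiemannHypothesis.RiemannHypothesis.Theorems.GroundBartaEvenWinsBeyondArchDeflationPoleLoc
import HarnessLib

/-!
# RiemannHypothesis / GroundBarta — rung 4 (`EvenWinsBeyondArch`, stmt-RiemannHypothesis-18807 / 18085):
# the E-piece of the R-layer residual on the BULK t-panels by GLOBAL Taylor expansion in `t` (lever #8, part 1)

Helper file (`--supports stmt-RiemannHypothesis-18085`), RH-free, no facts, standard axioms.

`…DeflationArchLoc1.dt_archETM` encloses `I_E(y) = ∫_{(0,c−y]} G(t)·(2g(y) − g(y−t) − g(y+t))/t dt` on a y-panel by contracting, for every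
FULL t-panel, a LOCAL Taylor table of `g` with the 33 central moments of `ρ(t_i + u)` (≈ 19 000 interval products per panel ≈ 40 s of
kernel time = 70 % of a Q file).  But the window function `g` is a POLYNOMIAL, so EXACTLY

  `g(y + t) = Σ_a t^a · (D_a g)(y)`  (`D_a` = Hasse derivative, `dt_hasseRowQ`),   `2g(y) − g(y−t) − g(y+t) = −2 Σ_{r} t^{2r+2} (D_{2r+2} g)(y)`,

and on the bulk t-range `[h, T]` (fixed limits) `G·E = ρ·(2g − g(·−t) − g(·+t))`, whence

  `∫_h^T ρ(t)(2g(y) − g(y−t) − g(y+t)) dt = −2 Σ_r (D_{2r+2} g)(y) · R_{2r+2}`,   `R_a := ∫_h^T ρ(t) t^a dt`  (UNIVERSAL per cell).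

This file: the Hasse rows and the two identities (`dt_eval_add_eq_sum_hasse`, `dt_symmDiff_eq_sum`), the universal RAW MOMENTS of `ρ`
over a run of t-panels from the central panel moments (`dt_rawMomI`, `dt_mem_rawMomI`), and the Taylor model of the bulk E-integral in
`ρ = y − y_k` from `≈ 17` exact local rows and `≈ 17` numbers (`dt_archEbulkTM`, `dt_tmem_archEbulk`).  Design + cost: HOME(B)/DESIGN-RLAYER-EGLOBAL.md.

References: E. Bombieri, Rend. Mat. Acc. Lincei (9) 11 (2000) Thm 2 [Bombieri2000Weil]; K. Makino, M. Berz, Int. J. Pure Appl. Math. 4 (2003) §6 [folklore].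
-/

set_option linter.dupNamespace false

noncomputable section

open MeasureTheory Set Filter intervalIntegral Finset
open scoped Topology BigOperators

namespace Summit.RiemannHypothesis.RiemannHypothesis.Theorems.EvenWinsBeyondArch

open Literature.NumberTheory.LFunctions
open Literature.Analysis.ValidatedNumerics Literature.Analysis.ValidatedNumerics.PolyMP
  Literature.Analysis.ValidatedNumerics.NumericsMP Literature.Analysis.ValidatedNumerics.ExpPoly

section HasseRows

/-- **Hasse row `a` of a coefficient list `g`**: `b ↦ g_{a+b}·C(a+b, a)`, so that `g(y + t) = Σ_a t^a · (row a)(y)`. -/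
def dt_hasseRowQ (g : Poly) (a : ℕ) : Poly :=
  (List.range (g.length - a)).map fun b ↦ g.getD (a + b) 0 * (((a + b).choose a : ℕ) : ℚ)

/-- length of a Hasse row -/
theorem dt_hasseRowQ_length (g : Poly) (a : ℕ) : (dt_hasseRowQ g a).length = g.length - a := by
  simp [dt_hasseRowQ]

/-- The Hasse row evaluates to `Σ_b g_{a+b} C(a+b,a) y^b`. -/
theorem dt_eval_hasseRowQ (g : Poly) (a : ℕ) (y : ℝ) :
    Poly.eval (dt_hasseRowQ g a) y =
      ∑ b ∈ range (g.length - a), ((g.getD (a + b) 0 : ℚ) : ℝ) * ((a + b).choose a : ℝ) * y ^ b := by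
  rw [Poly.eval_eq_evalR, evalR_eq_sum]
  simp only [List.length_map, dt_hasseRowQ, List.length_range]
  refine Finset.sum_congr rfl fun b hb ↦ ?_
  have hb' : b < g.length - a := Finset.mem_range.1 hb
  rw [List.getD_eq_getElem?_getD, List.getElem?_map, List.getElem?_map, List.getElem?_range hb']
  simp
  
/-- `(g.map ↑).getD i 0 = ↑(g.getD i 0)`. -/
theorem dt_getD_map_cast (g : Poly) (i : ℕ) : (g.map ((↑) : ℚ → ℝ)).getD i 0 = ((g.getD i 0 : ℚ) : ℝ) := by
  rw [List.getD_eq_getElem?_getD, List.getD_eq_getElem?_getD, List.getElem?_map]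
  cases g[i]? <;> simp

/-- **Taylor's formula for a coefficient list**: `g(y + t) = Σ_{a < len g} t^a · (row a)(y)`. -/
theorem dt_eval_add_eq_sum_hasse (g : Poly) (y t : ℝ) :
    Poly.eval g (y + t) = ∑ a ∈ range g.length, t ^ a * Poly.eval (dt_hasseRowQ g a) y := by
  rw [Poly.eval_eq_evalR, add_comm, evalR_add_eq_sum]
  simp only [List.length_map]
  refine Finset.sum_congr rfl fun a _ ↦ ?_
  rw [dt_eval_hasseRowQ]
  congr 1
  refine Finset.sum_congr rfl fun b _ ↦ ?_
  rw [dt_getD_map_cast]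

/-- Pairing a sum over `range (2N)` into even and odd indices. -/
theorem dt_sum_range_two_mul {M : Type*} [AddCommMonoid M] (f : ℕ → M) :
    ∀ N : ℕ, ∑ a ∈ range (2 * N), f a = ∑ r ∈ range N, (f (2 * r) + f (2 * r + 1))
  | 0 => by simp
  | N + 1 => by
      rw [show 2 * (N + 1) = 2 * N + 1 + 1 by ring, Finset.sum_range_succ, Finset.sum_range_succ, dt_sum_range_two_mul f N,
        Finset.sum_range_succ]
      ac_rfl

/-- Rows beyond the length are empty and evaluate to `0`. -/
theorem dt_eval_hasseRowQ_of_le (g : Poly) {a : ℕ} (ha : g.length ≤ a) (y : ℝ) : Poly.eval (dt_hasseRowQ g a) y = 0 := by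
  have : dt_hasseRowQ g a = [] := by simp [dt_hasseRowQ, Nat.sub_eq_zero_of_le ha]
  rw [this, Poly.eval_eq_evalR]; simp

/-- **The symmetric second difference of a polynomial**: with `N = len g`,
`2 g(y) − g(y−t) − g(y+t) = −2 · Σ_{r < N} t^{2r+2} · (row (2r+2))(y)` (rows beyond the degree are empty). -/
theorem dt_symmDiff_eq_sum (g : Poly) (y t : ℝ) :
    2 * Poly.eval g y - Poly.eval g (y - t) - Poly.eval g (y + t) =
      -2 * ∑ r ∈ range g.length, t ^ (2 * r + 2) * Poly.eval (dt_hasseRowQ g (2 * r + 2)) y := by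
  set N := g.length with hN
  set row : ℕ → ℝ := fun a ↦ Poly.eval (dt_hasseRowQ g a) y with hrow
  -- both Taylor sums, extended to the range 2N+2 (extra rows are empty)
  have hext : ∀ s : ℝ, Poly.eval g (y + s) = ∑ a ∈ range (2 * (N + 1)), s ^ a * row a := by
    intro s
    rw [dt_eval_add_eq_sum_hasse, ← hN]
    have hle : N ≤ 2 * (N + 1) := by omega
    rw [← Finset.sum_range_add_sum_Ico _ hle]
    have hz : ∑ a ∈ Finset.Ico N (2 * (N + 1)), s ^ a * row a = 0 :=
      Finset.sum_eq_zero fun a ha ↦ by rw [hrow]; simp only; rw [dt_eval_hasseRowQ_of_le g (Finset.mem_Ico.1 ha).1, mul_zero]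
    rw [hz, add_zero]
  have hp := hext t
  have hm : Poly.eval g (y - t) = ∑ a ∈ range (2 * (N + 1)), (-t) ^ a * row a := by
    rw [show y - t = y + -t by ring]; exact hext (-t)
  -- row 0 = g(y)
  have h0 : row 0 = Poly.eval g y := by
    have h1 := dt_eval_add_eq_sum_hasse g y 0
    rw [add_zero] at h1
    rw [hrow]; simp only
    rw [h1, ← hN]
    rcases Nat.eq_zero_or_pos N with hz | hpos
    · rw [hz, Finset.sum_range_zero, dt_eval_hasseRowQ_of_le g (by omega)]
    · rw [Finset.sum_eq_single 0 (fun a _ ha ↦ by rw [zero_pow ha, zero_mul]) (fun h ↦ absurd (Finset.mem_range.2 hpos) h)]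
      simp
  -- g(y−t) + g(y+t) = 2 Σ_{r ≤ N} t^{2r} row(2r) = 2 g(y) + 2 Σ_{r<N} t^{2r+2} row(2r+2)
  have hpair : Poly.eval g (y - t) + Poly.eval g (y + t) = ∑ r ∈ range (N + 1), 2 * (t ^ (2 * r) * row (2 * r)) := by
    rw [hm, hp, dt_sum_range_two_mul, dt_sum_range_two_mul, ← Finset.sum_add_distrib]
    refine Finset.sum_congr rfl fun r _ ↦ ?_
    rw [Even.neg_pow ⟨r, by ring⟩, Odd.neg_pow ⟨r, by ring⟩]
    ring
  have hshift : ∑ r ∈ range (N + 1), 2 * (t ^ (2 * r) * row (2 * r)) =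
      2 * Poly.eval g y + 2 * ∑ r ∈ range N, t ^ (2 * r + 2) * row (2 * r + 2) := by
    rw [Finset.sum_range_succ', pow_zero, one_mul, mul_zero, h0, Finset.mul_sum, add_comm]
    congr 1
  have hfin : ∑ r ∈ range N, t ^ (2 * r + 2) * row (2 * r + 2) =
      ∑ r ∈ range g.length, t ^ (2 * r + 2) * Poly.eval (dt_hasseRowQ g (2 * r + 2)) y := by
    rw [hN]
  rw [← hfin]
  linarith [hpair, hshift]

end HasseRows

section RawMoments

variable {S : ℕ} {c : ℚ} {m : ℕ}

/-- **Raw moments of `ρ` over a run of t-panels** `i0 ≤ i < i0 + n` (grid `h = c/(2m)`, centres `t_i = (2i+1)h`):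
`Σ_i Σ_{b≤a} C(a,b) t_i^{a−b} μ_{i,b}` in scaled interval arithmetic, from the central panel moments `μ_{i,b} ∋ ∫_{-h}^{h} ρ(t_i+u) u^b du`. -/
def dt_rawMomI (S : ℕ) (c : ℚ) (m : ℕ) (mu : ℕ → List MI) (i0 n a : ℕ) : MI :=
  (List.range n).foldl (fun acc j ↦ MI.add acc
    ((List.range (a + 1)).foldl (fun acc' b ↦ MI.add acc'
      (MI.mul S (ofRat S (((a.choose b : ℕ) : ℚ) * PolyMP.panelCentre (c / (2 * m)) (i0 + j) ^ (a - b)))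
        ((mu (i0 + j)).getD b default))) (MI.ofScaled 0))) (MI.ofScaled 0)

/-- One t-panel: `∫_{t_i−h}^{t_i+h} ρ(t) t^a dt = Σ_{b≤a} C(a,b) t_i^{a−b} ∫_{-h}^{h} ρ(t_i+u) u^b du`. -/
theorem dt_integral_panel_pow (hc : 0 < c) (hm : 0 < m) {i : ℕ} (hi : 1 ≤ i) (a : ℕ) :
    ∫ t in (((PolyMP.panelCentre (c / (2 * m)) i : ℚ) : ℝ) - ((c / (2 * m) : ℚ) : ℝ))..
        (((PolyMP.panelCentre (c / (2 * m)) i : ℚ) : ℝ) + ((c / (2 * m) : ℚ) : ℝ)), weilArchDensity t * t ^ a =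
      ∑ b ∈ range (a + 1), ((a.choose b : ℕ) : ℝ) * (((PolyMP.panelCentre (c / (2 * m)) i : ℚ) : ℝ)) ^ (a - b) *
        ∫ u in (-((c / (2 * m) : ℚ) : ℝ))..((c / (2 * m) : ℚ) : ℝ),
          weilArchDensity ((((PolyMP.panelCentre (c / (2 * m)) i : ℚ) : ℝ)) + u) * u ^ b := by
  set ti : ℝ := ((PolyMP.panelCentre (c / (2 * m)) i : ℚ) : ℝ) with hti
  set hh : ℝ := ((c / (2 * m) : ℚ) : ℝ) with hhh
  have hK := dt_continuousOn_K hc hm hi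
  -- substitute t = ti + u
  have hsub : ∫ t in (ti - hh)..(ti + hh), weilArchDensity t * t ^ a =
      ∫ u in (-hh)..hh, weilArchDensity (ti + u) * (ti + u) ^ a := by
    have := intervalIntegral.integral_comp_add_left (fun t ↦ weilArchDensity t * t ^ a) ti (a := -hh) (b := hh)
    rw [show ti + -hh = ti - hh by ring] at this
    exact this.symm
  rw [hsub]
  -- binomial expansion under the integral
  have hexp : ∀ u : ℝ, weilArchDensity (ti + u) * (ti + u) ^ a =
      ∑ b ∈ range (a + 1), ((a.choose b : ℕ) : ℝ) * ti ^ (a - b) * (weilArchDensity (ti + u) * u ^ b) := by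
    intro u
    have hpow : (ti + u) ^ a = ∑ b ∈ range (a + 1), u ^ b * ti ^ (a - b) * ((a.choose b : ℕ) : ℝ) := by
      rw [add_comm]; exact add_pow u ti a
    rw [hpow, Finset.mul_sum]
    refine Finset.sum_congr rfl fun b _ ↦ ?_
    ring
  simp_rw [hexp]
  have hint : ∀ b ∈ range (a + 1), IntervalIntegrable
      (fun u ↦ ((a.choose b : ℕ) : ℝ) * ti ^ (a - b) * (weilArchDensity (ti + u) * u ^ b)) volume (-hh) hh := by
    intro b _
    have h1 : IntervalIntegrable (fun u ↦ weilArchDensity (ti + u) * u ^ b) volume (-hh) hh :=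
      (hK.mul (continuousOn_pow b)).intervalIntegrable_of_Icc (by rw [hhh]; linarith [dt_h_pos hc hm])
    exact h1.const_mul (((a.choose b : ℕ) : ℝ) * ti ^ (a - b))
  rw [intervalIntegral.integral_finsetSum hint]
  refine Finset.sum_congr rfl fun b _ ↦ ?_
  rw [intervalIntegral.integral_const_mul]

/-- **Soundness of the raw moments**: for `1 ≤ i0`, `i0 + n ≤ 2m`, `a ≤ Dl`,
`∫_{2 i0 h}^{2(i0+n) h} ρ(t) t^a dt ∈ dt_rawMomI S c m mu i0 n a`. [cite: Bombieri2000Weil, Thm 2 (archimedean term)] -/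
theorem dt_mem_rawMomI (hS : 0 < S) (hc : 0 < c) (hm : 0 < m) {Dl : ℕ} {mu : ℕ → List MI}
    (hmu : ∀ i, 1 ≤ i → i < 2 * m → ∀ b, b < Dl + 1 →
      MI.mem S (∫ u in (-((c / (2 * m) : ℚ) : ℝ))..((c / (2 * m) : ℚ) : ℝ),
        weilArchDensity (((PolyMP.panelCentre (c / (2 * m)) i : ℚ) : ℝ) + u) * u ^ b) ((mu i).getD b default))
    {i0 : ℕ} (hi0 : 1 ≤ i0) {a : ℕ} (ha : a ≤ Dl) :
    ∀ n : ℕ, i0 + n ≤ 2 * m →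
      MI.mem S (∫ t in (2 * (i0 : ℝ) * ((c / (2 * m) : ℚ) : ℝ))..(2 * ((i0 + n : ℕ) : ℝ) * ((c / (2 * m) : ℚ) : ℝ)),
        weilArchDensity t * t ^ a) (dt_rawMomI S c m mu i0 n a) := by
  intro n hn
  set hh : ℝ := ((c / (2 * m) : ℚ) : ℝ) with hhh
  have hpos := dt_h_pos hc hm
  -- the integral as a sum of panel integrals
  have hpan : ∀ j, j < n → ∫ t in (2 * ((i0 + j : ℕ) : ℝ) * hh)..(2 * ((i0 + j + 1 : ℕ) : ℝ) * hh), weilArchDensity t * t ^ a =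
      ∑ b ∈ range (a + 1), ((a.choose b : ℕ) : ℝ) * (((PolyMP.panelCentre (c / (2 * m)) (i0 + j) : ℚ) : ℝ)) ^ (a - b) *
        ∫ u in (-hh)..hh, weilArchDensity ((((PolyMP.panelCentre (c / (2 * m)) (i0 + j) : ℚ) : ℝ)) + u) * u ^ b := by
    intro j hj
    have e1 : 2 * ((i0 + j : ℕ) : ℝ) * hh = (((PolyMP.panelCentre (c / (2 * m)) (i0 + j) : ℚ) : ℝ)) - hh := by
      rw [hhh, dt_tI_eq]; push_cast; ring
    have e2 : 2 * ((i0 + j + 1 : ℕ) : ℝ) * hh = (((PolyMP.panelCentre (c / (2 * m)) (i0 + j) : ℚ) : ℝ)) + hh := by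
      rw [hhh, dt_tI_eq]; push_cast; ring
    rw [e1, e2]
    exact dt_integral_panel_pow hc hm (by omega) a
  have hii : ∀ j, j ≤ n → IntervalIntegrable (fun t ↦ weilArchDensity t * t ^ a) volume
      (2 * (i0 : ℝ) * hh) (2 * ((i0 + j : ℕ) : ℝ) * hh) := by
    intro j _
    refine ((continuousOn_weilArchDensity.mono ?_).mul (continuousOn_pow a)).intervalIntegrable
    intro t ht
    have h1 : 2 * (i0 : ℝ) * hh ≤ t := by
      rcases Set.mem_uIcc.1 ht with h | h
      · exact h.1
      · have : (2 * (i0 : ℝ) * hh) ≤ 2 * ((i0 + j : ℕ) : ℝ) * hh := by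
          have : (i0 : ℝ) ≤ ((i0 + j : ℕ) : ℝ) := by exact_mod_cast Nat.le_add_right i0 j
          nlinarith
        exact this.trans h.1
    have h0 : (0 : ℝ) < 2 * (i0 : ℝ) * hh := by
      have : (1 : ℝ) ≤ i0 := by exact_mod_cast hi0
      positivity
    exact lt_of_lt_of_le h0 h1
  have hsplit : ∀ n', n' ≤ n → ∫ t in (2 * (i0 : ℝ) * hh)..(2 * ((i0 + n' : ℕ) : ℝ) * hh), weilArchDensity t * t ^ a =
      ∑ j ∈ range n', ∫ t in (2 * ((i0 + j : ℕ) : ℝ) * hh)..(2 * ((i0 + j + 1 : ℕ) : ℝ) * hh), weilArchDensity t * t ^ a := by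
    intro n' hn'
    induction n' with
    | zero => simp
    | succ n' ih =>
        rw [Finset.sum_range_succ, ← ih (by omega), intervalIntegral.integral_add_adjacent_intervals (hii n' (by omega))]
        · push_cast; ring_nf
        · have hb := hii (n' + 1) hn'
          have ha' := hii n' (by omega)
          exact (ha'.symm.trans hb)
  rw [hsplit n le_rfl]
  simp only [dt_rawMomI]
  refine mem_foldl_add n fun j hj ↦ ?_
  rw [hpan j hj]
  refine mem_foldl_add (a + 1) fun b hb ↦ ?_
  have hmem := hmu (i0 + j) (by omega) (by omega) b (by omega)
  have hq := mem_ofRat S (((a.choose b : ℕ) : ℚ) * PolyMP.panelCentre (c / (2 * m)) (i0 + j) ^ (a - b))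
  have := MI.mem_mul hS hq hmem
  push_cast at this
  convert this using 2

end RawMoments

section BulkE

variable {S : ℕ}

/-- Folded sum of Taylor models. -/
theorem dt_tmem_foldl_add {h : ℚ} {f : ℕ → ℝ → ℝ} {P : ℕ → IPoly} :
    ∀ n : ℕ, (∀ r, r < n → TMem S h (f r) (P r)) →
      TMem S h (fun ρ ↦ ∑ r ∈ range n, f r ρ) ((List.range n).foldl (fun acc r ↦ taddI acc (P r)) [])
  | 0, _ => fun ρ _ ↦ ⟨[], pmem_nil S, by simp⟩
  | n + 1, hP => by
      rw [List.range_succ, List.foldl_append, List.foldl_cons, List.foldl_nil]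
      have ih := dt_tmem_foldl_add n fun r hr ↦ hP r (by omega)
      have := tmem_add ih (hP n (by omega))
      refine tmem_congr_on this fun ρ _ ↦ ?_
      rw [Finset.sum_range_succ]

/-- The empty model encloses the zero function. -/
theorem dt_tmem_nil_of_zero {h : ℚ} {f : ℝ → ℝ} (hf : ∀ ρ, f ρ = 0) : TMem S h f [] :=
  fun ρ _ ↦ ⟨[], pmem_nil S, by simp [hf ρ]⟩

/-- `tsmulI` of the empty model is empty. -/
theorem dt_tsmulI_nil (S : ℕ) (C : MI) : tsmulI S C [] = [] := rfl

/-- `dt_locI` of the empty coefficient list is empty. -/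
theorem dt_locI_nil (S : ℕ) (C : MI) : dt_locI S [] C = [] := rfl

/-- **The bulk E-piece as a Taylor model in `ρ = y − y_k` by global expansion**: `−2 Σ_r R_{2r+2} · (row (2r+2))(y_k + ρ)`,
truncated to degree `Dl`; `R a ∋ ∫_A^B ρ(t) t^a dt` (the cell's universal raw moments of the bulk t-range of this y-panel). -/
def dt_archEbulkTM (S : ℕ) (h : ℚ) (Dl : ℕ) (g : Poly) (y0 : ℚ) (R : ℕ → MI) : IPoly :=
  ttruncI S h Dl (tsmulInt (-2) ((List.range g.length).foldl
    (fun acc r ↦ taddI acc (tsmulI S (R (2 * r + 2)) (dt_locI S (dt_hasseRowQ g (2 * r + 2)) (ofRat S y0)))) []))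

/-- **Soundness of the global-expansion E model.**  For `0 < A ≤ B`, `0 ≤ h` and raw-moment enclosures
`R (2r+2) ∋ ∫_A^B ρ(t) t^{2r+2} dt` for `2r+2 < len g`:
`TMem S h (ρ ↦ ∫_A^B ρ(t)·(2g(y₀+ρ) − g(y₀+ρ−t) − g(y₀+ρ+t)) dt) (dt_archEbulkTM S h Dl g y₀ R)`.
[cite: Bombieri2000Weil, Thm 2 (archimedean term)] -/
theorem dt_tmem_archEbulk (hS : 0 < S) {h : ℚ} (hh0 : 0 ≤ h) (Dl : ℕ) (g : Poly) (y0 : ℚ) {A B : ℝ} (hA : 0 < A) (hAB : A ≤ B)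
    {R : ℕ → MI} (hR : ∀ r : ℕ, 2 * r + 2 < g.length → MI.mem S (∫ t in A..B, weilArchDensity t * t ^ (2 * r + 2)) (R (2 * r + 2))) :
    TMem S h (fun ρ ↦ ∫ t in A..B, weilArchDensity t *
        (2 * Poly.eval g ((y0 : ℝ) + ρ) - Poly.eval g ((y0 : ℝ) + ρ - t) - Poly.eval g ((y0 : ℝ) + ρ + t)))
      (dt_archEbulkTM S h Dl g y0 R) := by
  -- continuity of ρ on [A, B]
  have hcont : ContinuousOn weilArchDensity (Set.uIcc A B) := by
    refine continuousOn_weilArchDensity.mono fun t ht ↦ ?_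
    rw [Set.uIcc_of_le hAB] at ht
    exact lt_of_lt_of_le hA ht.1
  have hint : ∀ a : ℕ, IntervalIntegrable (fun t ↦ weilArchDensity t * t ^ a) volume A B := fun a ↦
    (hcont.mul (continuousOn_pow a)).intervalIntegrable
  -- each term of the sum as a Taylor model
  have hterm : ∀ r, r < g.length → TMem S h
      (fun ρ ↦ (∫ t in A..B, weilArchDensity t * t ^ (2 * r + 2)) * Poly.eval (dt_hasseRowQ g (2 * r + 2)) ((y0 : ℝ) + ρ))
      (tsmulI S (R (2 * r + 2)) (dt_locI S (dt_hasseRowQ g (2 * r + 2)) (ofRat S y0))) := by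
    intro r _
    by_cases hlt : 2 * r + 2 < g.length
    · exact tmem_smulI hS (hR r hlt) (dt_tmem_locI hS h (dt_hasseRowQ g (2 * r + 2)) (mem_ofRat S y0))
    · have hrow : dt_hasseRowQ g (2 * r + 2) = [] := by
        simp [dt_hasseRowQ, Nat.sub_eq_zero_of_le (not_lt.1 hlt)]
      rw [hrow, dt_locI_nil, dt_tsmulI_nil]
      exact dt_tmem_nil_of_zero fun ρ ↦ by rw [Poly.eval_eq_evalR]; simp
  have hsum := dt_tmem_foldl_add (S := S) g.length hterm
  have hall := tmem_trunc hh0 Dl (tmem_smulInt (-2) hsum)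
  refine tmem_congr_on hall fun ρ _ ↦ ?_
  -- the integrand, expanded
  have hexp : ∀ t : ℝ, weilArchDensity t * (2 * Poly.eval g ((y0 : ℝ) + ρ) - Poly.eval g ((y0 : ℝ) + ρ - t) -
      Poly.eval g ((y0 : ℝ) + ρ + t)) =
      ∑ r ∈ range g.length, (-2 * Poly.eval (dt_hasseRowQ g (2 * r + 2)) ((y0 : ℝ) + ρ)) * (weilArchDensity t * t ^ (2 * r + 2)) := by
    intro t
    rw [dt_symmDiff_eq_sum g ((y0 : ℝ) + ρ) t, Finset.mul_sum, Finset.mul_sum]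
    refine Finset.sum_congr rfl fun r _ ↦ ?_
    ring
  simp_rw [hexp]
  rw [intervalIntegral.integral_finsetSum (fun r _ ↦ (hint (2 * r + 2)).const_mul _)]
  push_cast
  rw [Finset.mul_sum]
  refine Finset.sum_congr rfl fun r _ ↦ ?_
  rw [intervalIntegral.integral_const_mul]
  ring

end BulkE

end Summit.RiemannHypothesis.RiemannHypothesis.Theorems.EvenWinsBeyondArch
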